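import Summits.QuantumFields.YangMills.Theorems.FluctuationComparisonRegPrIntLS2BetaChartReadDescentOntoExpPoint
import Summits.QuantumFields.YangMills.Theorems.FluctuationComparisonRegPrIntLS2BetaGeodesicJensenLift
import Literature.MathematicalPhysics.QuantumFieldTheory.Balaban1983to89.B10Eq18SigmaSU2Window
import HarnessLib

/-!
# S2β · row C-M at level 0 «THE LEVEL-0 SIZE LETTER FROM ζ» ((C-M₀)): the chart-read relative field at level `0` IS the fine fluctuation read in the exponential chart,
# so its size letters are those of `ζ` — `‖↑(X 0 b)‖ ≤ ‖ζ b‖`, hence `hX0`, `‖X 0‖ ≤ c·η` and `hMT` of the c₁ station from the ONE letter `hζc : ‖ζ ℓ‖ ≤ c·η`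

Cell `ym3-torus` (YM ladder rung R3 = continuum `SU(2)` Yang–Mills on the three-torus at fixed lattice data — a RUNG: NOT d = 4, NOT infinite volume, NOT
a mass gap, NOT Clay).  Width seat «width 20» `ym3-torus-px20` (gen 25), FREE px helper on crux `stmt-QuantumFields-20520`, LINE g18-1 S2β, row C-M lineage
(✓p840608, ✓p841351 (px12), consumed by w4 g29's ✓p841381 (g3) ∕ (g4) `c1Budget_bkgRegRep`, which displays the level-0 size thrice: `(cX) (hcX) (hX0)`, `hζc`, `hMT`).
`--kind proof --supports stmt-QuantumFields-20520 --as helper`, count-neutral, DEFINITION-FREE (0 `def`, 0 `instance`, 0 `notation`, 0 `sorry`, default heartbeats).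
Generic lattice `P` and ANY one-step averaging family `av` (the station's `fun k => blockAvg ℰp` is an instance); `hXdef` is the station's definition of the chart
tower VERBATIM with `av` in place of the `ℰp` block average.

WHAT IS PROVED (sorry-free).  ★`norm_chartRead_zero_le : ‖↑(X 0 b)‖ ≤ ‖ζ b‖` (`Ū⁰ = id` by `rfl`; `expPoint(ζ b)·U₀ b·(U₀ b)⁻¹ = expPoint(ζ b)`; lit ✓`norm_su2Coord`,
✓`norm_rev`; ✓`norm_logVec_su2Quat_expPoint_le`); ★`norm_chartRead_zero_le_of_letter` (`hX0` of `hζc`, i.e. `cX := c`); ★`pinorm_chartRead_zero_le` (`‖X 0‖ ≤ c·η`);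
★`transported_size_le_of_letter` (`hMT` of `hζc` with `mT := Λ̄·c`, given `L^k·η ≤ 1`).

HONEST SCOPE.  Chart bookkeeping at level 0; `hζc` ([Balaban1985RegularSpaces] Thm 2 (1.36) at the representative) remains a HYPOTHESIS of the consumer; nothing of
Bałaban's renormalisation-group analysis is asserted or proved; GAP♯∘ (`stub_uniformFibreGapOrbit`, registry v11 3732b7df UNTOUCHED, 0∕5), the five registered stubs, S2β,
crux 20520, 19936, 19200 and `YM3TorusSU2` are NOT proved; no registered stub is closed; rung R3 — NOT d = 4, NOT infinite volume, NOT a mass gap, NOT Clay; the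
Yang–Mills mass gap is NOT proved.  Axioms standard.
-/

set_option autoImplicit false

noncomputable section

open scoped Matrix.Norms.L2Operator

namespace Summit.QuantumFields.YangMills.Theorems.FluctuationComparisonRegPrIntLS2BetaChartReadLevelZeroSize

open Literature.MathematicalPhysics.QuantumFieldTheory.Balaban1983to89
open Literature.MathematicalPhysics.QuantumFieldTheory.Balaban1983to89.T4HaarSU2ExpChart (expPoint)
open Literature.MathematicalPhysics.QuantumFieldTheory.Balaban1983to89.T4ExpWindowSmallField (logVec)
open Literature.MathematicalPhysics.QuantumFieldTheory.Balaban1983to89.HaarExponentialChart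
open Literature.MathematicalPhysics.QuantumFieldTheory.Balaban1983to89.HaarExponentialChart.IsChartRep
open Literature.MathematicalPhysics.QuantumFieldTheory.Balaban1983to89.B10Eq18SigmaSU2 (su2Coord)
open Literature.MathematicalPhysics.QuantumFieldTheory.Balaban1983to89.B10Eq18SigmaSU2Haar (rev norm_rev)
open Literature.MathematicalPhysics.QuantumFieldTheory.Balaban1983to89.B10Eq18SigmaSU2Window (norm_su2Coord)
open Literature.MathematicalPhysics.QuantumLattice (su2Quat)
open Summit.QuantumFields.YangMills.Theorems.FluctuationComparisonRegPrIntLS2BetaChartReadDescentOntoExpPoint (su2Coord_rev_mem_lie)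
open Summit.QuantumFields.YangMills.Theorems.FluctuationComparisonRegPrIntLS2BetaGeodesicJensenLift (norm_logVec_su2Quat_expPoint_le)

variable {P : Params}

/-- ★ **THE CHART-READ RELATIVE FIELD AT LEVEL 0 IS BOUNDED BY THE FINE FLUCTUATION**: with `X i b := coords(logVec(Ūⁱ(e^{ζ}U₀)(b)·Ūⁱ(U₀)(b)⁻¹))`, at `i = 0`
(`Ū⁰ = id`) `‖↑(X 0 b)‖ = ‖logVec (su2Quat (expPoint (ζ b)))‖ ≤ ‖ζ b‖` (lit ✓`norm_su2Coord`, ✓`norm_rev`; ✓`norm_logVec_su2Quat_expPoint_le`). [folklore] -/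
theorem norm_chartRead_zero_le (av : ∀ j, Averaging P j (Matrix.specialUnitaryGroup (Fin 2) ℂ))
    (U₀ : GaugeField P 0 (Matrix.specialUnitaryGroup (Fin 2) ℂ)) (ζ : PBond P 0 → EuclideanSpace ℝ (Fin 3))
    (X : (i : ℕ) → PBond P i → (specialUnitaryLogChart (Fin 2)).lie)
    (hXdef : X = fun (i : ℕ) (b : PBond P i) =>
      (⟨su2Coord (rev (logVec (su2Quat (Averaging.iter av i (fun ℓ => expPoint (ζ ℓ) * U₀ ℓ : GaugeField P 0 (Matrix.specialUnitaryGroup (Fin 2) ℂ)) b * (Averaging.iter av i U₀ b)⁻¹)))), su2Coord_rev_mem_lie _⟩ : (specialUnitaryLogChart (Fin 2)).lie))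
    (b : PBond P 0) :
    ‖((X 0 b : (specialUnitaryLogChart (Fin 2)).lie) : Matrix (Fin 2) (Fin 2) ℂ)‖ ≤ ‖ζ b‖ := by
  subst hXdef
  show ‖su2Coord (rev (logVec (su2Quat ((expPoint (ζ b) * U₀ b) * (U₀ b)⁻¹))))‖ ≤ ‖ζ b‖
  rw [norm_su2Coord, norm_rev, mul_inv_cancel_right]
  exact norm_logVec_su2Quat_expPoint_le (ζ b)

/-- ★ **`hX0` OF `hζc`**: the station's level-0 chart size letter with `cX := c`: `‖ζ ℓ‖ ≤ c·η` for all `ℓ` gives `‖↑(X 0 b)‖ ≤ c·η` for all `b`.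
[cite: Balaban1985RegularSpaces, Thm 2 (1.36) p.82] -/
theorem norm_chartRead_zero_le_of_letter (av : ∀ j, Averaging P j (Matrix.specialUnitaryGroup (Fin 2) ℂ))
    (U₀ : GaugeField P 0 (Matrix.specialUnitaryGroup (Fin 2) ℂ)) (ζ : PBond P 0 → EuclideanSpace ℝ (Fin 3))
    (X : (i : ℕ) → PBond P i → (specialUnitaryLogChart (Fin 2)).lie)
    (hXdef : X = fun (i : ℕ) (b : PBond P i) =>
      (⟨su2Coord (rev (logVec (su2Quat (Averaging.iter av i (fun ℓ => expPoint (ζ ℓ) * U₀ ℓ : GaugeField P 0 (Matrix.specialUnitaryGroup (Fin 2) ℂ)) b * (Averaging.iter av i U₀ b)⁻¹)))), su2Coord_rev_mem_lie _⟩ : (specialUnitaryLogChart (Fin 2)).lie))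
    {c η : ℝ} (hζc : ∀ ℓ : PBond P 0, ‖ζ ℓ‖ ≤ c * η) :
    ∀ b : PBond P 0, ‖((X 0 b : (specialUnitaryLogChart (Fin 2)).lie) : Matrix (Fin 2) (Fin 2) ℂ)‖ ≤ c * η :=
  fun b => (norm_chartRead_zero_le av U₀ ζ X hXdef b).trans (hζc b)

/-- ★ **THE SUP NORM AT LEVEL 0**: `‖X 0‖ ≤ c·η` from `hζc` (`0 ≤ c·η`). [cite: Balaban1985RegularSpaces, Thm 2 (1.36) p.82] -/
theorem pinorm_chartRead_zero_le (av : ∀ j, Averaging P j (Matrix.specialUnitaryGroup (Fin 2) ℂ))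
    (U₀ : GaugeField P 0 (Matrix.specialUnitaryGroup (Fin 2) ℂ)) (ζ : PBond P 0 → EuclideanSpace ℝ (Fin 3))
    (X : (i : ℕ) → PBond P i → (specialUnitaryLogChart (Fin 2)).lie)
    (hXdef : X = fun (i : ℕ) (b : PBond P i) =>
      (⟨su2Coord (rev (logVec (su2Quat (Averaging.iter av i (fun ℓ => expPoint (ζ ℓ) * U₀ ℓ : GaugeField P 0 (Matrix.specialUnitaryGroup (Fin 2) ℂ)) b * (Averaging.iter av i U₀ b)⁻¹)))), su2Coord_rev_mem_lie _⟩ : (specialUnitaryLogChart (Fin 2)).lie))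
    {c η : ℝ} (hcη : 0 ≤ c * η) (hζc : ∀ ℓ : PBond P 0, ‖ζ ℓ‖ ≤ c * η) :
    ‖X 0‖ ≤ c * η := by
  refine (pi_norm_le_iff_of_nonneg hcη).2 fun b => ?_
  rw [← Submodule.norm_coe]
  exact norm_chartRead_zero_le_of_letter av U₀ ζ X hXdef hζc b

/-- ★ **`hMT` OF `hζc`**: the transported-size letter with `mT := Λ̄·c`: for `0 ≤ Λ̄`, `0 ≤ c`, `0 ≤ η` and `L^k·η ≤ 1`, `Λ̄·L^k·‖X 0‖ ≤ Λ̄·c`.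
[cite: Balaban1985RegularSpaces, Thm 2 (1.36) p.82; Balaban1985Averaging, Prop. 4 (130) p.37] -/
theorem transported_size_le_of_letter (av : ∀ j, Averaging P j (Matrix.specialUnitaryGroup (Fin 2) ℂ))
    (U₀ : GaugeField P 0 (Matrix.specialUnitaryGroup (Fin 2) ℂ)) (ζ : PBond P 0 → EuclideanSpace ℝ (Fin 3))
    (X : (i : ℕ) → PBond P i → (specialUnitaryLogChart (Fin 2)).lie)
    (hXdef : X = fun (i : ℕ) (b : PBond P i) =>
      (⟨su2Coord (rev (logVec (su2Quat (Averaging.iter av i (fun ℓ => expPoint (ζ ℓ) * U₀ ℓ : GaugeField P 0 (Matrix.specialUnitaryGroup (Fin 2) ℂ)) b * (Averaging.iter av i U₀ b)⁻¹)))), su2Coord_rev_mem_lie _⟩ : (specialUnitaryLogChart (Fin 2)).lie))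
    {c η Λb L : ℝ} (hΛb : 0 ≤ Λb) (hc : 0 ≤ c) (hη : 0 ≤ η) (hζc : ∀ ℓ : PBond P 0, ‖ζ ℓ‖ ≤ c * η)
    (k : ℕ) (hL : 0 ≤ L) (hθ : L ^ k * η ≤ 1) :
    Λb * L ^ k * ‖X 0‖ ≤ Λb * c := by
  have hX := pinorm_chartRead_zero_le av U₀ ζ X hXdef (mul_nonneg hc hη) hζc
  have hLk : 0 ≤ L ^ k := pow_nonneg hL k
  calc Λb * L ^ k * ‖X 0‖ ≤ Λb * L ^ k * (c * η) := mul_le_mul_of_nonneg_left hX (mul_nonneg hΛb hLk)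
    _ = Λb * c * (L ^ k * η) := by ring
    _ ≤ Λb * c * 1 := mul_le_mul_of_nonneg_left hθ (mul_nonneg hΛb hc)
    _ = Λb * c := mul_one _

end Summit.QuantumFields.YangMills.Theorems.FluctuationComparisonRegPrIntLS2BetaChartReadLevelZeroSize

end
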